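import Summits.HodgeConjecture.HodgeConjecture.Theorems.R90S2ArchCuspPinDefs    -- ★ S2 FILE 1 (R90-C11-typ1): `ccTransport`, `HasArchOpTrace` plumbing, `GInf`∕`HInf`∕`phi3` (via ★ S10 kit)
import Summits.HodgeConjecture.HodgeConjecture.Theorems.R90S2ArchPureTensor     -- ★ CARD 2 (K2E3-p25): `archTensor`, `archTensor₂`
import Literature.NumberTheory.Automorphic.HilbertRepSpectrum                  -- ★ `IsSquareIntegrableRep`, `ContRepresentation.AreUnitarilyEquivalent`
import HarnessLib

/-!
# R90-TF ∕ S2 «Ch. 12 archimedean block» — `R90S2TensorRepLetterDefs`: LETTERS-DEFS part ℓ3 — the generic EXTERNAL-TENSOR-PRODUCT letters along a factorisation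
# `e : Γ ≃ₜ* ∏_i G_i` (existence with trace multiplicativity, exhaustion, uniqueness), the read-backs `archTensor = piPure archPiEquivCM` (G- and H-side), and the
# two instance SHAPES `ArchTensorRepLettersG ∕ H`

Cell `pub/hodgecm-mathlib`, HCML Track R90-TF, section S2 (base `R90-C11`), crux h413 = `stmt-HodgeConjecture-24833`, route of record `HCCMUnconditional`;
prover seat LH7-p07 (g2) on S2 dealer K2E1b-plan (g8)'s card 2026-09-05T02:07:22Z (`PAYMENT-ROADS-S2.v1` §2 (4) LETTERS, part ℓ3); §1–§4 = the dealer's elaborated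
probe `PROBE-LETTERS-L3-TensorRep.v1` (b1e305de17404693) VERBATIM with docstrings, §5 (H-side) added here.  Lane `--kind definition --supports stmt-HodgeConjecture-24833
--as helper` (count-neutral).  Conventions of the S2 Defs files: no socket, no instance, no notation, no `sorry`, default heartbeats; `open scoped Classical` for the
`Fintype`∕`DecidableEq` of the complex places (S2 convention).

## CONTENTS
* §1 `ccPiTensor (φ : ∀ i, C_c(G i, ℂ)) : C_c((∀ i, G i), ℂ)` (`g ↦ ∏_i φ_i (g i)`, Tychonoff-box support) + `_apply`; `piPure (e : Γ ≃ₜ ∀ i, G i) φ : C_c(Γ, ℂ)`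
  (`:= ccTransport e.symm (ccPiTensor φ)`) + `piPure_apply` (`rfl`).
* §2 `archTensor_eq_piPure` — ★ CARD 2's `archTensor L H φ` IS `piPure (archPiEquivCM L H).toHomeomorph φ`.
* §3 THE LETTERS (closed-shape parametrised `Prop`s over ANY factorisation `e : Γ ≃ₜ* ∀ i, G i` and measures `νΓ`, `ν i`; NOTHING asserted):
  `HasLocalComponents` («`σ ≅ ⊠_i π_i` read through traces: traces multiply on pure tensors whenever all local traces exist; square-integrable iff every factor is»),
  ℓ3-A `TensorRepExists`, ℓ3-B `TensorRepExhausts`, ℓ3-U `TensorRepUnique`; `hasLocalComponents_iff`; `HasLocalComponents.hasArchOpTrace_zero_of_place`.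
* §4 G-side instance SHAPE `ArchTensorRepLettersG L` (ℓ3-A ∧ ℓ3-B ∧ ℓ3-U at ★ `archPiEquivCM L (phi3 L)` for Haar measures matched along the factorisation) + `_iff`.
* §5 H-side: `archPiEquivCM₂ L H₁ H₂ : U(H₁)_∞ × U(H₂)_∞ ≃ₜ* ∏_w (U(σ_w H₁)(ℂ) × U(σ_w H₂)(ℂ))` (the two ★ `archPiEquivCM` paired place by place) + `_apply`,
  `_apply_fst`, `_apply_snd` (`rfl`: ★ FILE 1 `IsArchFactoredAtPlace₂`'s pairs ARE its components); `archTensor₂_eq_piPure` (★ CARD 2's `archTensor₂` IS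
  `piPure archPiEquivCM₂`); H-side instance SHAPE `ArchTensorRepLettersH L` (at ★ `HInf L`, the `Φ₂, Φ₁` literals) + `_iff`.

## WHY THESE SHAPES (assembly use, `PAYMENT-ROADS-S2.v1` §1)
T2 (a)(c) read ℓ3-A at the local packet members; (d) «trace `0` on every irreducible unitary `π ≇ ϖ_k`» from ℓ3-B (local components of `π`) + the local letters (local traces
`∈ {0, 1}`) + `hasArchOpTrace_zero_of_place`, and in the all-ones case ℓ3-U + ★ `hasArchOpTrace_unique` give `π ≅ ϖ_k`; the discrete-series bookkeeping rides on the
`IsSquareIntegrableRep` conjunct.  The measure matching `ν.map e = Measure.pi νw` is produced assembly-side (Haar rescaling card).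

HONEST LABEL: closed `Prop`s assert nothing and pay nothing; the letters become S2 SOCKETS only when a Lines edition states them (D ED. 3); the printed inputs behind them
are the external tensor product theorem for irreducible unitary representations of type-I groups (Dixmier §13.1.8; Flath 1979 Thm. 1 for the restricted-product analogue;
reductive Lie groups are of type I, Harish-Chandra 1953).  HC_CM is proved only modulo the 7 printed citations (2 remaining named inputs: hLiu418 =
`stmt-HodgeConjecture-24832`, h413 = `stmt-HodgeConjecture-24833`) until rung 0 closes.  Count-neutral.

References: [Dixmier1977] §13.1.8; [Flath1979] Thm. 1; [BorelJacquet1979] §4.1; [Rogawski1990] §13.8 p. 218, §14.3 p. 234; [HarishChandra1953].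
-/

set_option autoImplicit false
set_option linter.dupNamespace false

noncomputable section

open MeasureTheory NumberField NumberField.InfinitePlace CompactlySupported
open scoped Matrix MatrixGroups InnerProductSpace
open Literature.NumberTheory.Automorphic Literature.NumberTheory.Automorphic.UnitaryGroup
open Summit.HodgeConjecture.HodgeConjecture.Cruxes.H413.K2E1bGKCohomologyU21.U8 (HasArchOpTrace)

namespace Summit.HodgeConjecture.HodgeConjecture.R90.S2

/-! ## §1 Pure tensors on a finite product of spaces -/

section PiTensor

variable {ι : Type*} [Fintype ι] {G : ι → Type*} [∀ i, TopologicalSpace (G i)]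

/-- **PURE TENSOR ON A FINITE PRODUCT OF SPACES**: `⊗_i φ_i : (∀ i, G i) → ℂ`, `g ↦ ∏_i φ_i (g i)`, continuous with compact support (inside the Tychonoff box
`∏_i tsupport φ_i`). [cite: BorelJacquet1979, §4.1] -/
def ccPiTensor (φ : ∀ i, C_c(G i, ℂ)) : C_c((∀ i, G i), ℂ) where
  toFun g := ∏ i, φ i (g i)
  continuous_toFun := continuous_finsetProd _ fun i _ => (φ i).continuous.comp (continuous_apply i)
  hasCompactSupport' := by
    refine HasCompactSupport.intro' (K := Set.pi Set.univ fun i => tsupport ⇑(φ i))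
      (isCompact_univ_pi fun i => (φ i).hasCompactSupport.isCompact) (isClosed_set_pi fun i _ => isClosed_tsupport _) ?_
    intro g hg
    simp only [Set.mem_univ_pi, not_forall] at hg
    obtain ⟨i, hi⟩ := hg
    exact Finset.prod_eq_zero (Finset.mem_univ i) (image_eq_zero_of_notMem_tsupport hi)

/-- Read-back (definitional). [cite: BorelJacquet1979, §4.1] -/
@[simp] theorem ccPiTensor_apply (φ : ∀ i, C_c(G i, ℂ)) (g : ∀ i, G i) : ccPiTensor φ g = ∏ i, φ i (g i) := rfl

variable {Γ : Type*} [TopologicalSpace Γ]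

/-- **PURE TENSORS PULLED BACK TO `Γ`** along a homeomorphism `e : Γ ≃ₜ ∀ i, G i`: `γ ↦ ∏_i φ_i ((e γ) i)` (★ `ccTransport` of `ccPiTensor`). [cite: BorelJacquet1979, §4.1] -/
def piPure (e : Γ ≃ₜ (∀ i, G i)) (φ : ∀ i, C_c(G i, ℂ)) : C_c(Γ, ℂ) :=
  ccTransport e.symm (ccPiTensor φ)

/-- Read-back (definitional): `piPure e φ γ = ∏_i φ_i ((e γ) i)`. [cite: BorelJacquet1979, §4.1] -/
@[simp] theorem piPure_apply (e : Γ ≃ₜ (∀ i, G i)) (φ : ∀ i, C_c(G i, ℂ)) (γ : Γ) :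
    piPure e φ γ = ∏ i, φ i (e γ i) := rfl

end PiTensor

/-! ## §2 The arch read-back: ★ CARD 2's `archTensor` is `piPure archPiEquivCM` -/

section Arch

variable (L : Type) [Field L] [NumberField L] [IsCMField L] {N : ℕ} (H : Matrix (Fin N) (Fin N) L)

open scoped Classical in
/-- **CARD 2's `archTensor` IS the generic pure tensor at ★ `archPiEquivCM`**: `archTensor L H φ = piPure (archPiEquivCM L H).toHomeomorph φ` (`rfl` pointwise).
[cite: BorelJacquet1979, §4.1] -/
theorem archTensor_eq_piPure (φ : ∀ w : {w : InfinitePlace L // w.IsComplex}, C_c(↥(archLocal L N H w), ℂ)) :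
    archTensor L H φ = piPure (archPiEquivCM L H (N := N)).toHomeomorph φ := by
  ext g; rfl

end Arch

/-! ## §3 The letters (closed-shape parametrised `Prop`s; nothing asserted) -/

section Letters

variable {Γ : Type*} [Group Γ] [TopologicalSpace Γ] [MeasurableSpace Γ] [BorelSpace Γ]
  {ι : Type} [Fintype ι] {G : ι → Type} [∀ i, Group (G i)] [∀ i, TopologicalSpace (G i)]
  [∀ i, MeasurableSpace (G i)] [∀ i, BorelSpace (G i)]

/-- **`σ` HAS LOCAL COMPONENTS `π = (π_i)` ALONG `e : Γ ≃ₜ* ∏_i G_i`** (w.r.t. the measures `νΓ` on `Γ` and `ν_i` on `G_i`): the external tensor product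
`σ ≅ ⊠_i π_i` READ THROUGH TRACES — operator traces MULTIPLY on pure tensors whenever every local trace exists (`tr σ(⊗ φ_i) = ∏_i tr π_i(φ_i)`, ★ U8
`HasArchOpTrace`), and `σ` is square-integrable iff every factor is (★ `IsSquareIntegrableRep`).  A closed-shape parametrised `Prop`; nothing asserted.
[cite: Dixmier1977, §13.1.8] [cite: Flath1979, Thm. 1] [cite: BorelJacquet1979, §4.1] -/
def HasLocalComponents (e : Γ ≃ₜ* (∀ i, G i)) (νΓ : Measure Γ) [IsFiniteMeasureOnCompacts νΓ]
    (ν : ∀ i, Measure (G i)) [∀ i, IsFiniteMeasureOnCompacts (ν i)]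
    {E : Type} [NormedAddCommGroup E] [InnerProductSpace ℂ E] [CompleteSpace E]
    (σ : ContRepresentation ℂ Γ E) (hu : σ.IsUnitary) (hsc : σ.IsStronglyContinuous)
    (Eι : ι → Type) [∀ i, NormedAddCommGroup (Eι i)] [∀ i, InnerProductSpace ℂ (Eι i)] [∀ i, CompleteSpace (Eι i)]
    (π : ∀ i, ContRepresentation ℂ (G i) (Eι i)) (huι : ∀ i, (π i).IsUnitary) (hscι : ∀ i, (π i).IsStronglyContinuous) : Prop :=
  (∀ (φ : ∀ i, C_c(G i, ℂ)) (t : ι → ℂ), (∀ i, HasArchOpTrace (ν i) (π i) (huι i) (hscι i) (φ i) (t i)) →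
      HasArchOpTrace νΓ σ hu hsc (piPure e.toHomeomorph φ) (∏ i, t i)) ∧
    (IsSquareIntegrableRep νΓ σ ↔ ∀ i, IsSquareIntegrableRep (ν i) (π i))

/-- **LETTER ℓ3-A (EXISTENCE OF THE EXTERNAL TENSOR PRODUCT)**: every family of irreducible unitary strongly continuous representations `π_i` of the factors `G_i`
has an irreducible unitary strongly continuous representation `σ` of `Γ` with local components `π` along `e` (the completed Hilbert tensor product `⊠_i π_i` of
irreducible unitary representations of type-I groups is irreducible; reductive Lie groups are of type I — Harish-Chandra 1953).  Closed-shape parametrised `Prop`,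
nothing asserted; it becomes an S2 socket only when a Lines edition states it. [cite: Dixmier1977, §13.1.8] [cite: Flath1979, Thm. 1] -/
def TensorRepExists (e : Γ ≃ₜ* (∀ i, G i)) (νΓ : Measure Γ) [IsFiniteMeasureOnCompacts νΓ]
    (ν : ∀ i, Measure (G i)) [∀ i, IsFiniteMeasureOnCompacts (ν i)] : Prop :=
  ∀ (Eι : ι → Type) [∀ i, NormedAddCommGroup (Eι i)] [∀ i, InnerProductSpace ℂ (Eι i)] [∀ i, CompleteSpace (Eι i)]
    (π : ∀ i, ContRepresentation ℂ (G i) (Eι i)) (huι : ∀ i, (π i).IsUnitary) (hscι : ∀ i, (π i).IsStronglyContinuous),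
    (∀ i, (π i).IsTopIrreducible) →
      ∃ (E : Type) (_ : NormedAddCommGroup E) (_ : InnerProductSpace ℂ E) (_ : CompleteSpace E)
        (σ : ContRepresentation ℂ Γ E) (hu : σ.IsUnitary) (hsc : σ.IsStronglyContinuous),
        σ.IsTopIrreducible ∧ HasLocalComponents e νΓ ν σ hu hsc Eι π huι hscι

/-- **LETTER ℓ3-B (EXHAUSTION)**: every irreducible unitary strongly continuous representation `σ` of `Γ ≅ ∏_i G_i` has irreducible unitary local components along `e`
(`σ ≅ ⊠_i π_i` for type-I factors).  Closed-shape parametrised `Prop`, nothing asserted. [cite: Dixmier1977, §13.1.8] [cite: Flath1979, Thm. 1] -/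
def TensorRepExhausts (e : Γ ≃ₜ* (∀ i, G i)) (νΓ : Measure Γ) [IsFiniteMeasureOnCompacts νΓ]
    (ν : ∀ i, Measure (G i)) [∀ i, IsFiniteMeasureOnCompacts (ν i)] : Prop :=
  ∀ (E : Type) [NormedAddCommGroup E] [InnerProductSpace ℂ E] [CompleteSpace E]
    (σ : ContRepresentation ℂ Γ E) (hu : σ.IsUnitary) (hsc : σ.IsStronglyContinuous), σ.IsTopIrreducible →
      ∃ (Eι : ι → Type) (_ : ∀ i, NormedAddCommGroup (Eι i)) (_ : ∀ i, InnerProductSpace ℂ (Eι i)) (_ : ∀ i, CompleteSpace (Eι i))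
        (π : ∀ i, ContRepresentation ℂ (G i) (Eι i)) (huι : ∀ i, (π i).IsUnitary) (hscι : ∀ i, (π i).IsStronglyContinuous),
        (∀ i, (π i).IsTopIrreducible) ∧ HasLocalComponents e νΓ ν σ hu hsc Eι π huι hscι

/-- **LETTER ℓ3-U (THE PRODUCT IS DETERMINED BY ITS LOCAL COMPONENTS)**: two irreducible unitary strongly continuous representations of `Γ` whose local components
along `e` are place-wise unitarily equivalent are unitarily equivalent (★ `ContRepresentation.AreUnitarilyEquivalent`).  Closed-shape parametrised `Prop`, nothing
asserted. [cite: Dixmier1977, §13.1.8] [cite: Flath1979, Thm. 1] -/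
def TensorRepUnique (e : Γ ≃ₜ* (∀ i, G i)) (νΓ : Measure Γ) [IsFiniteMeasureOnCompacts νΓ]
    (ν : ∀ i, Measure (G i)) [∀ i, IsFiniteMeasureOnCompacts (ν i)] : Prop :=
  ∀ (E E' : Type) [NormedAddCommGroup E] [InnerProductSpace ℂ E] [CompleteSpace E]
    [NormedAddCommGroup E'] [InnerProductSpace ℂ E'] [CompleteSpace E']
    (σ : ContRepresentation ℂ Γ E) (hu : σ.IsUnitary) (hsc : σ.IsStronglyContinuous)
    (σ' : ContRepresentation ℂ Γ E') (hu' : σ'.IsUnitary) (hsc' : σ'.IsStronglyContinuous)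
    (Eι Eι' : ι → Type) [∀ i, NormedAddCommGroup (Eι i)] [∀ i, InnerProductSpace ℂ (Eι i)] [∀ i, CompleteSpace (Eι i)]
    [∀ i, NormedAddCommGroup (Eι' i)] [∀ i, InnerProductSpace ℂ (Eι' i)] [∀ i, CompleteSpace (Eι' i)]
    (π : ∀ i, ContRepresentation ℂ (G i) (Eι i)) (huι : ∀ i, (π i).IsUnitary) (hscι : ∀ i, (π i).IsStronglyContinuous)
    (π' : ∀ i, ContRepresentation ℂ (G i) (Eι' i)) (huι' : ∀ i, (π' i).IsUnitary) (hscι' : ∀ i, (π' i).IsStronglyContinuous),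
    σ.IsTopIrreducible → σ'.IsTopIrreducible → (∀ i, (π i).IsTopIrreducible) → (∀ i, (π' i).IsTopIrreducible) →
    HasLocalComponents e νΓ ν σ hu hsc Eι π huι hscι → HasLocalComponents e νΓ ν σ' hu' hsc' Eι' π' huι' hscι' →
    (∀ i, ContRepresentation.AreUnitarilyEquivalent (π i) (π' i)) → ContRepresentation.AreUnitarilyEquivalent σ σ'

/-- Unfolding of `HasLocalComponents` (definitional). [cite: Dixmier1977, §13.1.8] -/
theorem hasLocalComponents_iff (e : Γ ≃ₜ* (∀ i, G i)) (νΓ : Measure Γ) [IsFiniteMeasureOnCompacts νΓ]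
    (ν : ∀ i, Measure (G i)) [∀ i, IsFiniteMeasureOnCompacts (ν i)]
    {E : Type} [NormedAddCommGroup E] [InnerProductSpace ℂ E] [CompleteSpace E]
    (σ : ContRepresentation ℂ Γ E) (hu : σ.IsUnitary) (hsc : σ.IsStronglyContinuous)
    (Eι : ι → Type) [∀ i, NormedAddCommGroup (Eι i)] [∀ i, InnerProductSpace ℂ (Eι i)] [∀ i, CompleteSpace (Eι i)]
    (π : ∀ i, ContRepresentation ℂ (G i) (Eι i)) (huι : ∀ i, (π i).IsUnitary) (hscι : ∀ i, (π i).IsStronglyContinuous) :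
    HasLocalComponents e νΓ ν σ hu hsc Eι π huι hscι ↔
      (∀ (φ : ∀ i, C_c(G i, ℂ)) (t : ι → ℂ), (∀ i, HasArchOpTrace (ν i) (π i) (huι i) (hscι i) (φ i) (t i)) →
          HasArchOpTrace νΓ σ hu hsc (piPure e.toHomeomorph φ) (∏ i, t i)) ∧
        (IsSquareIntegrableRep νΓ σ ↔ ∀ i, IsSquareIntegrableRep (ν i) (π i)) :=
  Iff.rfl

/-- **THE CONSEQUENCE SHAPE THE T2 ASSEMBLY USES**: under `HasLocalComponents`, ONE vanishing local trace makes the product trace `0` on the pure tensor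
(`Finset.prod_eq_zero`). [cite: Rogawski1990, §13.8 p. 218] [cite: Dixmier1977, §13.1.8] -/
theorem HasLocalComponents.hasArchOpTrace_zero_of_place {e : Γ ≃ₜ* (∀ i, G i)} {νΓ : Measure Γ} [IsFiniteMeasureOnCompacts νΓ]
    {ν : ∀ i, Measure (G i)} [∀ i, IsFiniteMeasureOnCompacts (ν i)]
    {E : Type} [NormedAddCommGroup E] [InnerProductSpace ℂ E] [CompleteSpace E]
    {σ : ContRepresentation ℂ Γ E} {hu : σ.IsUnitary} {hsc : σ.IsStronglyContinuous}
    {Eι : ι → Type} [∀ i, NormedAddCommGroup (Eι i)] [∀ i, InnerProductSpace ℂ (Eι i)] [∀ i, CompleteSpace (Eι i)]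
    {π : ∀ i, ContRepresentation ℂ (G i) (Eι i)} {huι : ∀ i, (π i).IsUnitary} {hscι : ∀ i, (π i).IsStronglyContinuous}
    (h : HasLocalComponents e νΓ ν σ hu hsc Eι π huι hscι) (φ : ∀ i, C_c(G i, ℂ)) (t : ι → ℂ)
    (ht : ∀ i, HasArchOpTrace (ν i) (π i) (huι i) (hscι i) (φ i) (t i)) (i₀ : ι) (h0 : t i₀ = 0) :
    HasArchOpTrace νΓ σ hu hsc (piPure e.toHomeomorph φ) 0 := by
  have := h.1 φ t ht
  rwa [Finset.prod_eq_zero (Finset.mem_univ i₀) h0] at this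

end Letters

/-! ## §4 The G-side instance shape (what the Lines socket will assert, for the record) -/

section GInstance

variable (L : Type) [Field L] [NumberField L] [IsCMField L]

open Summit.HodgeConjecture.HodgeConjecture.R90.S10 (phi3 GInf)

open scoped Classical in
/-- **THE G-SIDE TENSOR LETTERS AT `archPiEquivCM`** (`G_∞ = U(Φ₃)(L⁺ ⊗ ℝ) ≅ ∏_w U(2,1)`), for Haar measures matched along the factorisation
(`ν.map archPiEquivCM = Measure.pi νw`): ℓ3-A ∧ ℓ3-B ∧ ℓ3-U.  The SHAPE a Lines edition (D ED. 3) will assert as a socket; closed `Prop`, nothing asserted here.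
(Print: Dixmier §13.1.8; Flath 1979 Thm. 1; Rogawski §13.8 p. 218 — a header-binder-free `Prop`, hence untagged (S2 house rule 2026-09-05T02:23:15Z); the
citation tokens are carried by `archTensorRepLettersG_iff`.) -/
def ArchTensorRepLettersG : Prop :=
  ∀ [MeasurableSpace (GInf L)] [BorelSpace (GInf L)] (ν : Measure (GInf L)) [ν.IsHaarMeasure]
    [∀ w : {w : InfinitePlace L // w.IsComplex}, MeasurableSpace ↥(archLocal L 3 (phi3 L) w)]
    [∀ w : {w : InfinitePlace L // w.IsComplex}, BorelSpace ↥(archLocal L 3 (phi3 L) w)]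
    (νw : ∀ w : {w : InfinitePlace L // w.IsComplex}, Measure ↥(archLocal L 3 (phi3 L) w)) [∀ w, (νw w).IsHaarMeasure],
    ν.map ⇑(archPiEquivCM L (phi3 L) (N := 3)) = Measure.pi νw →
      TensorRepExists (archPiEquivCM L (phi3 L) (N := 3)) ν νw ∧ TensorRepExhausts (archPiEquivCM L (phi3 L) (N := 3)) ν νw ∧
        TensorRepUnique (archPiEquivCM L (phi3 L) (N := 3)) ν νw


open scoped Classical in
/-- Unfolding of `ArchTensorRepLettersG` (definitional; carries the letters' locators). [cite: Dixmier1977, §13.1.8] [cite: Flath1979, Thm. 1] [cite: Rogawski1990, §13.8 p. 218] -/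
theorem archTensorRepLettersG_iff :
    ArchTensorRepLettersG L ↔
      ∀ [MeasurableSpace (GInf L)] [BorelSpace (GInf L)] (ν : Measure (GInf L)) [ν.IsHaarMeasure]
        [∀ w : {w : InfinitePlace L // w.IsComplex}, MeasurableSpace ↥(archLocal L 3 (phi3 L) w)]
        [∀ w : {w : InfinitePlace L // w.IsComplex}, BorelSpace ↥(archLocal L 3 (phi3 L) w)]
        (νw : ∀ w : {w : InfinitePlace L // w.IsComplex}, Measure ↥(archLocal L 3 (phi3 L) w)) [∀ w, (νw w).IsHaarMeasure],
        ν.map ⇑(archPiEquivCM L (phi3 L) (N := 3)) = Measure.pi νw →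
          TensorRepExists (archPiEquivCM L (phi3 L) (N := 3)) ν νw ∧ TensorRepExhausts (archPiEquivCM L (phi3 L) (N := 3)) ν νw ∧
            TensorRepUnique (archPiEquivCM L (phi3 L) (N := 3)) ν νw :=
  Iff.rfl

end GInstance

/-! ## §5 The H-side: the two-factor factorisation `H_∞ = (U(Φ₂) × U(Φ₁))(L⁺ ⊗ ℝ) ≅ ∏_w (U(σ_w Φ₂)(ℂ) × U(σ_w Φ₁)(ℂ))` and its tensor letters -/

section HSide

variable (L : Type) [Field L] [NumberField L] [IsCMField L] {N₁ N₂ : ℕ} (H₁ : Matrix (Fin N₁) (Fin N₁) L) (H₂ : Matrix (Fin N₂) (Fin N₂) L)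

/-- **THE TWO-FACTOR ARCHIMEDEAN FACTORISATION** `U(H₁)(L⁺ ⊗ ℝ) × U(H₂)(L⁺ ⊗ ℝ) ≃ₜ* ∏_w (U(σ_w H₁)(ℂ) × U(σ_w H₂)(ℂ))` — the two ★ `archPiEquivCM` paired place by place
(`g ↦ (w ↦ ((archPiEquivCM g.1)_w, (archPiEquivCM g.2)_w))`), a topological-group isomorphism; at the `Φ₂, Φ₁` literals its source is ★ `HInf L` by `rfl`.
[cite: BorelJacquet1979, §4.1] [cite: Rogawski1990, §14.3 p. 234] -/
def archPiEquivCM₂ :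
    (↥(arch (↥(maximalRealSubfield L)) L (IsCMField.complexConj L) N₁ H₁) × ↥(arch (↥(maximalRealSubfield L)) L (IsCMField.complexConj L) N₂ H₂)) ≃ₜ*
      (∀ w : {w : InfinitePlace L // w.IsComplex}, ↥(archLocal L N₁ H₁ w) × ↥(archLocal L N₂ H₂ w)) where
  toFun g w := (archPiEquivCM L H₁ (N := N₁) g.1 w, archPiEquivCM L H₂ (N := N₂) g.2 w)
  invFun h := ((archPiEquivCM L H₁ (N := N₁)).symm fun w => (h w).1, (archPiEquivCM L H₂ (N := N₂)).symm fun w => (h w).2)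
  left_inv g := Prod.ext ((archPiEquivCM L H₁ (N := N₁)).symm_apply_apply g.1) ((archPiEquivCM L H₂ (N := N₂)).symm_apply_apply g.2)
  right_inv h := funext fun w =>
    Prod.ext (congrFun ((archPiEquivCM L H₁ (N := N₁)).apply_symm_apply fun w => (h w).1) w)
      (congrFun ((archPiEquivCM L H₂ (N := N₂)).apply_symm_apply fun w => (h w).2) w)
  map_mul' g g' := funext fun w => by
    simp only [Prod.fst_mul, Prod.snd_mul, map_mul, Pi.mul_apply, Prod.mk_mul_mk]
  continuous_toFun :=
    continuous_pi fun w =>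
      (((continuous_apply w).comp (archPiEquivCM L H₁ (N := N₁)).continuous).comp continuous_fst).prodMk
        (((continuous_apply w).comp (archPiEquivCM L H₂ (N := N₂)).continuous).comp continuous_snd)
  continuous_invFun :=
    ((archPiEquivCM L H₁ (N := N₁)).symm.continuous.comp (continuous_pi fun w => continuous_fst.comp (continuous_apply w))).prodMk
      ((archPiEquivCM L H₂ (N := N₂)).symm.continuous.comp (continuous_pi fun w => continuous_snd.comp (continuous_apply w)))

/-- Read-back (definitional): `archPiEquivCM₂ L H₁ H₂ g w = ((archPiEquivCM g.1)_w, (archPiEquivCM g.2)_w)`. [cite: BorelJacquet1979, §4.1] -/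
@[simp] theorem archPiEquivCM₂_apply
    (g : ↥(arch (↥(maximalRealSubfield L)) L (IsCMField.complexConj L) N₁ H₁) × ↥(arch (↥(maximalRealSubfield L)) L (IsCMField.complexConj L) N₂ H₂))
    (w : {w : InfinitePlace L // w.IsComplex}) :
    archPiEquivCM₂ L H₁ H₂ g w = (archPiEquivCM L H₁ (N := N₁) g.1 w, archPiEquivCM L H₂ (N := N₂) g.2 w) := rfl

/-- Read-back, first component (★ FILE 1 `IsArchFactoredAtPlace₂`'s pair IS the `w`-component, by `rfl`). [cite: BorelJacquet1979, §4.1] -/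
theorem archPiEquivCM₂_apply_fst
    (g : ↥(arch (↥(maximalRealSubfield L)) L (IsCMField.complexConj L) N₁ H₁) × ↥(arch (↥(maximalRealSubfield L)) L (IsCMField.complexConj L) N₂ H₂))
    (w : {w : InfinitePlace L // w.IsComplex}) :
    (archPiEquivCM₂ L H₁ H₂ g w).1 = archPiEquivCM L H₁ (N := N₁) g.1 w := rfl

/-- Read-back, second component. [cite: BorelJacquet1979, §4.1] -/
theorem archPiEquivCM₂_apply_snd
    (g : ↥(arch (↥(maximalRealSubfield L)) L (IsCMField.complexConj L) N₁ H₁) × ↥(arch (↥(maximalRealSubfield L)) L (IsCMField.complexConj L) N₂ H₂))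
    (w : {w : InfinitePlace L // w.IsComplex}) :
    (archPiEquivCM₂ L H₁ H₂ g w).2 = archPiEquivCM L H₂ (N := N₂) g.2 w := rfl

open scoped Classical in
/-- **CARD 2's two-factor tensor `archTensor₂` IS the generic pure tensor at `archPiEquivCM₂`**: `archTensor₂ L H₁ H₂ φ₂ = piPure (archPiEquivCM₂ L H₁ H₂).toHomeomorph φ₂`
(`rfl` pointwise). [cite: BorelJacquet1979, §4.1] -/
theorem archTensor₂_eq_piPure
    (φ₂ : ∀ w : {w : InfinitePlace L // w.IsComplex}, C_c(↥(archLocal L N₁ H₁ w) × ↥(archLocal L N₂ H₂ w), ℂ)) :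
    archTensor₂ L H₁ H₂ φ₂ = piPure (archPiEquivCM₂ L H₁ H₂).toHomeomorph φ₂ := by
  ext g; rfl

open Summit.HodgeConjecture.HodgeConjecture.R90.S10 (HInf)

open scoped Classical in
/-- **THE H-SIDE TENSOR LETTERS AT `archPiEquivCM₂`** (`H_∞ = (U(Φ₂) × U(Φ₁))(L⁺ ⊗ ℝ) ≅ ∏_w (U(1,1) × U(1))`, ★ `HInf L` at the `Φ₂, Φ₁` literals), for Haar measures matched
along the factorisation (`νH.map archPiEquivCM₂ = Measure.pi νHw`): ℓ3-A ∧ ℓ3-B ∧ ℓ3-U.  The SHAPE a Lines edition will assert; closed `Prop`, nothing asserted here.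
(Print: Dixmier §13.1.8; Flath 1979 Thm. 1; Rogawski §13.8 p. 218 — a header-binder-free `Prop`, hence untagged (S2 house rule 2026-09-05T02:23:15Z); the
citation tokens are carried by `archTensorRepLettersH_iff`.) -/
def ArchTensorRepLettersH : Prop :=
  ∀ [MeasurableSpace (HInf L)] [BorelSpace (HInf L)] (νH : Measure (HInf L)) [νH.IsHaarMeasure]
    [∀ w : {w : InfinitePlace L // w.IsComplex},
      MeasurableSpace (↥(archLocal L 2 (Matrix.of fun i j : Fin 2 => if i.val + j.val + 1 = 2 then (1 : L) else 0) w) × ↥(archLocal L 1 (Matrix.of fun i j : Fin 1 => if i.val + j.val + 1 = 1 then (1 : L) else 0) w))]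
    [∀ w : {w : InfinitePlace L // w.IsComplex},
      BorelSpace (↥(archLocal L 2 (Matrix.of fun i j : Fin 2 => if i.val + j.val + 1 = 2 then (1 : L) else 0) w) × ↥(archLocal L 1 (Matrix.of fun i j : Fin 1 => if i.val + j.val + 1 = 1 then (1 : L) else 0) w))]
    (νHw : ∀ w : {w : InfinitePlace L // w.IsComplex}, Measure (↥(archLocal L 2 (Matrix.of fun i j : Fin 2 => if i.val + j.val + 1 = 2 then (1 : L) else 0) w) × ↥(archLocal L 1 (Matrix.of fun i j : Fin 1 => if i.val + j.val + 1 = 1 then (1 : L) else 0) w)))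
    [∀ w, (νHw w).IsHaarMeasure],
    νH.map ⇑(archPiEquivCM₂ L (Matrix.of fun i j : Fin 2 => if i.val + j.val + 1 = 2 then (1 : L) else 0) (Matrix.of fun i j : Fin 1 => if i.val + j.val + 1 = 1 then (1 : L) else 0)) = Measure.pi νHw →
      TensorRepExists (archPiEquivCM₂ L (Matrix.of fun i j : Fin 2 => if i.val + j.val + 1 = 2 then (1 : L) else 0) (Matrix.of fun i j : Fin 1 => if i.val + j.val + 1 = 1 then (1 : L) else 0)) νH νHw ∧ TensorRepExhausts (archPiEquivCM₂ L (Matrix.of fun i j : Fin 2 => if i.val + j.val + 1 = 2 then (1 : L) else 0) (Matrix.of fun i j : Fin 1 => if i.val + j.val + 1 = 1 then (1 : L) else 0)) νH νHw ∧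
        TensorRepUnique (archPiEquivCM₂ L (Matrix.of fun i j : Fin 2 => if i.val + j.val + 1 = 2 then (1 : L) else 0) (Matrix.of fun i j : Fin 1 => if i.val + j.val + 1 = 1 then (1 : L) else 0)) νH νHw

open scoped Classical in
/-- Unfolding of `ArchTensorRepLettersH` (definitional; carries the letters' locators). [cite: Dixmier1977, §13.1.8] [cite: Flath1979, Thm. 1] [cite: Rogawski1990, §13.8 p. 218] -/
theorem archTensorRepLettersH_iff :
    ArchTensorRepLettersH L ↔
      ∀ [MeasurableSpace (HInf L)] [BorelSpace (HInf L)] (νH : Measure (HInf L)) [νH.IsHaarMeasure]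
        [∀ w : {w : InfinitePlace L // w.IsComplex},
          MeasurableSpace (↥(archLocal L 2 (Matrix.of fun i j : Fin 2 => if i.val + j.val + 1 = 2 then (1 : L) else 0) w) × ↥(archLocal L 1 (Matrix.of fun i j : Fin 1 => if i.val + j.val + 1 = 1 then (1 : L) else 0) w))]
        [∀ w : {w : InfinitePlace L // w.IsComplex},
          BorelSpace (↥(archLocal L 2 (Matrix.of fun i j : Fin 2 => if i.val + j.val + 1 = 2 then (1 : L) else 0) w) × ↥(archLocal L 1 (Matrix.of fun i j : Fin 1 => if i.val + j.val + 1 = 1 then (1 : L) else 0) w))]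
        (νHw : ∀ w : {w : InfinitePlace L // w.IsComplex}, Measure (↥(archLocal L 2 (Matrix.of fun i j : Fin 2 => if i.val + j.val + 1 = 2 then (1 : L) else 0) w) × ↥(archLocal L 1 (Matrix.of fun i j : Fin 1 => if i.val + j.val + 1 = 1 then (1 : L) else 0) w)))
        [∀ w, (νHw w).IsHaarMeasure],
        νH.map ⇑(archPiEquivCM₂ L (Matrix.of fun i j : Fin 2 => if i.val + j.val + 1 = 2 then (1 : L) else 0) (Matrix.of fun i j : Fin 1 => if i.val + j.val + 1 = 1 then (1 : L) else 0)) = Measure.pi νHw →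
          TensorRepExists (archPiEquivCM₂ L (Matrix.of fun i j : Fin 2 => if i.val + j.val + 1 = 2 then (1 : L) else 0) (Matrix.of fun i j : Fin 1 => if i.val + j.val + 1 = 1 then (1 : L) else 0)) νH νHw ∧ TensorRepExhausts (archPiEquivCM₂ L (Matrix.of fun i j : Fin 2 => if i.val + j.val + 1 = 2 then (1 : L) else 0) (Matrix.of fun i j : Fin 1 => if i.val + j.val + 1 = 1 then (1 : L) else 0)) νH νHw ∧
            TensorRepUnique (archPiEquivCM₂ L (Matrix.of fun i j : Fin 2 => if i.val + j.val + 1 = 2 then (1 : L) else 0) (Matrix.of fun i j : Fin 1 => if i.val + j.val + 1 = 1 then (1 : L) else 0)) νH νHw :=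
  Iff.rfl

end HSide

end Summit.HodgeConjecture.HodgeConjecture.R90.S2

end
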